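import Mathlib
import HarnessLib

/-!
# The two-point problem for `A u'' + B u' = 0` with continuous coefficients

Topic `Literature/Analysis/ODE`; one theorem.  For `A, B` continuous on a compact interval `[p, q]`
(`p < q`) with `A > 0` there, and prescribed endpoint values `yp, yq`, there is a globally `C²`
function `u : ℝ → ℝ` (given with global derivative data `u₁ = u'`, `u₂ = u''`, `u₂` continuous)
with `u p = yp`, `u q = yq` and `A u₂ + B u₁ = 0` on `[p, q]`
(`exists_classical_twoPoint_of_continuousOn`).  Construction: extend `P = B/A` continuously to
`ℝ` by clamping the argument to `[p, q]`, and take `u = yp + c ∫_p exp(-∫_p P)`.  This is the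
continuous-coefficient companion of `Literature.Analysis.ODE.exists_classical_twoPoint`
(`ViscosityLinearSecondOrder.lean`, smooth coefficients on an open interval), in the format
consumed by mean-value / maximum-principle comparison arguments on a closed interval (e.g. the
kernel-ODE maximum principle of the crux line `crossing-martingale` of `CardyRigidity`,
stmt-CriticalPhenomena-0746).

Mathlib: `intervalIntegral.integral_hasDerivAt_right`, `intervalIntegral.intervalIntegral_pos_of_pos_on`.

References: E. A. Coddington, N. Levinson, *Theory of Ordinary Differential Equations* (1955),
Ch. 1 (linear equations by quadrature); elementary.
-/

noncomputable section

open Set Filter Topology MeasureTheory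

namespace Literature.Analysis.ODE

/-- **Two-point solutions with continuous coefficients.**  Let `p < q`, `A, B` continuous on
`[p, q]`, `A > 0` on `[p, q]`.  For all `yp yq` there are `u u₁ u₂ : ℝ → ℝ` with `u` continuous,
`u p = yp`, `u q = yq`, `HasDerivAt u (u₁ η) η` and `HasDerivAt u₁ (u₂ η) η` for every real `η`,
`u₂` continuous, and `A η * u₂ η + B η * u₁ η = 0` for all `η ∈ [p, q]`. [folklore] -/
theorem exists_classical_twoPoint_of_continuousOn {A B : ℝ → ℝ} {p q : ℝ} (hpq : p < q)
    (hA : ContinuousOn A (Icc p q)) (hB : ContinuousOn B (Icc p q)) (hpos : ∀ η ∈ Icc p q, 0 < A η)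
    (yp yq : ℝ) :
    ∃ u u₁ u₂ : ℝ → ℝ, Continuous u ∧ u p = yp ∧ u q = yq ∧ (∀ η, HasDerivAt u (u₁ η) η) ∧
      (∀ η, HasDerivAt u₁ (u₂ η) η) ∧ Continuous u₂ ∧
      ∀ η ∈ Icc p q, A η * u₂ η + B η * u₁ η = 0 := by
  -- clamp to `[p, q]` and extend `P = B/A` continuously to `ℝ`
  set cl : ℝ → ℝ := fun η ↦ max p (min q η) with hcl
  have hcl_cont : Continuous cl := continuous_const.max (continuous_const.min continuous_id)
  have hcl_mem : ∀ η, cl η ∈ Icc p q := fun η ↦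
    ⟨le_max_left _ _, max_le hpq.le (min_le_left _ _)⟩
  have hcl_id : ∀ η ∈ Icc p q, cl η = η := fun η hη ↦ by
    simp only [hcl, min_eq_right hη.2, max_eq_right hη.1]
  set P : ℝ → ℝ := fun η ↦ B (cl η) / A (cl η) with hP
  have hAc : Continuous fun η ↦ A (cl η) := hA.comp_continuous hcl_cont hcl_mem
  have hBc : Continuous fun η ↦ B (cl η) := hB.comp_continuous hcl_cont hcl_mem
  have hPc : Continuous P := hBc.div hAc fun η ↦ (hpos _ (hcl_mem η)).ne'
  -- primitives of continuous functions
  have prim : ∀ {g : ℝ → ℝ}, Continuous g → ∀ η, HasDerivAt (fun η ↦ ∫ s in p..η, g s) (g η) η :=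
    fun hg η ↦ intervalIntegral.integral_hasDerivAt_right (hg.intervalIntegrable _ _)
      (hg.stronglyMeasurableAtFilter _ _) hg.continuousAt
  set IP : ℝ → ℝ := fun η ↦ ∫ s in p..η, P s with hIP
  set E : ℝ → ℝ := fun η ↦ Real.exp (-IP η) with hE
  have hEd : ∀ η, HasDerivAt E (Real.exp (-IP η) * -P η) η := fun η ↦ (prim hPc η).neg.exp
  have hEc : Continuous E := continuous_iff_continuousAt.2 fun η ↦ (hEd η).continuousAt
  have hEpos : ∀ η, 0 < E η := fun η ↦ Real.exp_pos _
  set Φ : ℝ → ℝ := fun η ↦ ∫ s in p..η, E s with hΦ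
  have hΦd : ∀ η, HasDerivAt Φ (E η) η := prim hEc
  have hΦp : Φ p = 0 := by simp [hΦ]
  have hΦq : 0 < Φ q :=
    intervalIntegral.intervalIntegral_pos_of_pos_on (hEc.intervalIntegrable _ _) (fun η _ ↦ hEpos η) hpq
  set c := (yq - yp) / Φ q with hc
  refine ⟨fun η ↦ yp + c * Φ η, fun η ↦ c * E η, fun η ↦ c * (Real.exp (-IP η) * -P η),
    ?_, ?_, ?_, ?_, ?_, ?_, ?_⟩
  · exact continuous_const.add (continuous_const.mul
      (continuous_iff_continuousAt.2 fun η ↦ (hΦd η).continuousAt))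
  · simp [hΦp]
  · simp only [hc]; field_simp; ring
  · intro η; simpa using ((hΦd η).const_mul c).const_add yp
  · intro η; exact (hEd η).const_mul c
  · exact continuous_const.mul ((Real.continuous_exp.comp (continuous_iff_continuousAt.2 fun η ↦
      (prim hPc η).continuousAt).neg).mul hPc.neg)
  · intro η hη
    have hAne : A η ≠ 0 := (hpos η hη).ne'
    have hPη : P η = B η / A η := by simp only [hP, hcl_id η hη]
    show A η * (c * (Real.exp (-IP η) * -P η)) + B η * (c * E η) = 0
    rw [hPη]
    field_simp
    ring

end Literature.Analysis.ODE

end
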